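import Summits.AnomalousDissipation.AnomalousDissipation.Theorems.SawtoothPulseCascadeK2CrossStreamIdentity
import Literature.Analysis.FunctionSpaces.TorusLerayHelmholtzH1
import Literature.Analysis.FunctionSpaces.TorusSpaceTimeTaylor
import Literature.Analysis.FunctionSpaces.TorusClassicalNSUniqueness

/-!
# K2″: the pressure of a linearised response is the RAPID pressure `Δq = −2 Σᵢⱼ (∂ᵢūⱼ)(∂ⱼwᵢ)`; on a V half-slot
# `Δq = −2 rateV·U_j′(x₀) ∂₁w₀`
(route `AnomalousDissipation/SawtoothPulseCascade`, crux K2″ = stmt-AnomalousDissipation-19696 `K2LinearisedCascadeGrowth`,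
line `phase-cocycle`, stubs A/B; helper, `--supports`; sequel of `…K2CrossStreamIdentity`)

`…K2CrossStreamIdentity` (p799289) shows that on a V half-slot the cross-stream energy `∫ w₀²` of a classical solution of
`∂ₜw + (ū·∇)w + (w·∇)ū = νΔw − ∇q`, `div w = 0`, changes only through viscosity and the pressure–cross-stream correlation
`∫ w₀ ∂₀q`.  This file identifies the pressure, in the tree's torus calculus: taking the divergence of the equation
(`div ∂ₜw = 0`: `IsSmoothSpaceTimeOn.isDivFree_timeDerivWithin`; `div Δw = 0`; `div ∇q = Δq`) leaves the classical RAPID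
pressure of rapid-distortion / Orr–Sommerfeld theory,
`Δq = −div((ū·∇)w + (w·∇)ū) = −2 Σᵢⱼ (∂ᵢūⱼ)(∂ⱼwᵢ)`, and for the vertical pulse `ū = (0, rateV j t · U_j(x₀))`
(`∂₁ū = 0`, `∂₀ū = c e₁`, `c = rateV j t · U_j′(x₀)`): `Δq = −2 c ∂₁w₀` — a closed system for the cross-stream component.

* §1 calculus on `𝕋^d`: `laplacian_apply_coord` (`(Δw)ᵢ = Δ(wᵢ)`), `divergence_laplacian_eq_zero` (`div Δw = 0` for
  `div w = 0`), `divergence_convect_eq_sum_sum` (`div((u·∇)w) = Σᵢⱼ (∂ᵢuⱼ)(∂ⱼwᵢ)` for `div w = 0`; the tree's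
  `divergence_convect_self` with two fields);
* §2 `laplacian_pressure_eq` — GENERIC: for a classical linearised solution along a smooth divergence-free carrier on
  `[a, b] × 𝕋^d`, `Δq(t, x) = −2 Σᵢⱼ (∂ᵢu)ⱼ (∂ⱼw)ᵢ`;
* §3 `laplacian_pressure_eq_of_mem_V` — on a V half-slot of the cascade: `Δq = −2 (rateV j t · U_j′(x₀)) (∂₁w)₀`.
-/

-- `Summit.<Summit>.<Problem>` is the tree's mandated summit-side namespace (CONVENTIONS §2); for this
-- single-conjunct summit the two coincide, so the duplicate is deliberate (lakefile: off for `Summits`).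
set_option linter.dupNamespace false

noncomputable section

namespace Summit.AnomalousDissipation.AnomalousDissipation.Theorems.SawtoothPulseCascade.K2Classical

open Set MeasureTheory Filter
open scoped InnerProductSpace ContDiff Topology
open Literature.Analysis Literature.Analysis.FunctionSpaces Literature.Analysis.FluidPDE
open Literature.Analysis.FluidPDE.SawtoothCascade
open Literature.Analysis.FluidPDE.SawtoothCascade.CascadeParams

/-! ## §1 Calculus on `𝕋^d` -/

section Calculus

variable {d : Type*} [Fintype d] [DecidableEq d]

/-- `((u·∇)w)ᵢ = Σⱼ uⱼ ∂ⱼwᵢ` for `C¹` `w`. [folklore] -/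
private theorem convect_apply_coord_sum' {u w : UnitAddTorus d → EuclideanSpace ℝ d} (hw : Torus.IsContDiff 1 w)
    (y : UnitAddTorus d) (i : d) :
    Torus.convect u w y i = ∑ j, u y j * Torus.partialDeriv j w y i := by
  rw [Torus.convect, Torus.fderiv_apply_eq_sum_partialDeriv hw y (u y)]
  simp only [WithLp.ofLp_sum, WithLp.ofLp_smul, Finset.sum_apply, Pi.smul_apply, smul_eq_mul]

/-- **Coordinates commute with the Laplacian**: `(Δw)(x)ᵢ = Δ(wᵢ)(x)` for smooth `w` (`Δ = Σⱼ ∂ⱼ∂ⱼ` and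
`Torus.partialDeriv_apply_coord` twice). [folklore] -/
theorem laplacian_apply_coord {w : UnitAddTorus d → EuclideanSpace ℝ d} (hw : Torus.IsSmooth w)
    (x : UnitAddTorus d) (i : d) :
    Torus.laplacian w x i = Torus.laplacian (fun y => w y i) x := by
  rw [Torus.laplacian_eq_sum_partialDeriv_partialDeriv hw,
    Torus.laplacian_eq_sum_partialDeriv_partialDeriv (hw.apply i), WithLp.ofLp_sum, Finset.sum_apply]
  refine Finset.sum_congr rfl fun j _ => ?_
  have h1 : Torus.IsContDiff 1 (Torus.partialDeriv j w) := (hw.partialDeriv j).isContDiff (by simp)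
  have hfun : (fun y => Torus.partialDeriv j w y i) = Torus.partialDeriv j (fun y => w y i) :=
    funext fun y => (Torus.partialDeriv_apply_coord (hw.isContDiff (by simp)) j y i).symm
  rw [← Torus.partialDeriv_apply_coord h1 j x i, hfun]

/-- **`div Δw = 0` for smooth divergence-free `w`**: `div Δw = Σᵢⱼ ∂ⱼ∂ⱼ∂ᵢwᵢ = Σⱼ ∂ⱼ∂ⱼ (div w) = 0` (Schwarz
`Torus.partialDeriv_laplacian_comm`). [folklore] -/
theorem divergence_laplacian_eq_zero {w : UnitAddTorus d → EuclideanSpace ℝ d} (hw : Torus.IsSmooth w)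
    (hdiv : Torus.IsDivFree w) (x : UnitAddTorus d) :
    Torus.divergence (Torus.laplacian w) x = 0 := by
  rw [Torus.divergence]
  have hcoord : ∀ i, (fun y => Torus.laplacian w y i) = Torus.laplacian (fun y => w y i) :=
    fun i => funext fun y => laplacian_apply_coord hw y i
  simp_rw [hcoord]
  have h2 : ∀ i, Torus.partialDeriv i (Torus.laplacian (fun y => w y i)) x =
      ∑ j, Torus.partialDeriv j (Torus.partialDeriv j (Torus.partialDeriv i (fun y => w y i))) x := by
    intro i
    rw [Torus.partialDeriv_laplacian_comm (hw.apply i),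
      Torus.laplacian_eq_sum_partialDeriv_partialDeriv ((hw.apply i).partialDeriv i)]
  simp_rw [h2]
  rw [Finset.sum_comm]
  have hC1 : ∀ i, Torus.IsContDiff 1 (Torus.partialDeriv i (fun y => w y i)) :=
    fun i => ((hw.apply i).partialDeriv i).isContDiff (by simp)
  have hC1' : ∀ j i, Torus.IsContDiff 1 (Torus.partialDeriv j (Torus.partialDeriv i (fun y => w y i))) :=
    fun j i => (((hw.apply i).partialDeriv i).partialDeriv j).isContDiff (by simp)
  have hdivfun : (fun y => ∑ i, Torus.partialDeriv i (fun z => w z i) y) = fun _ => (0 : ℝ) :=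
    funext fun y => hdiv y
  refine Finset.sum_eq_zero fun j _ => ?_
  rw [← Torus.partialDeriv_finset_sum _ (fun i _ => hC1' j i)]
  have hinner : (fun y => ∑ i ∈ Finset.univ, Torus.partialDeriv j (Torus.partialDeriv i (fun z => w z i)) y) =
      Torus.partialDeriv j (fun y => ∑ i, Torus.partialDeriv i (fun z => w z i) y) := by
    funext y
    rw [Torus.partialDeriv_finset_sum _ (fun i _ => hC1 i)]
  rw [hinner, hdivfun]
  simp [Torus.partialDeriv, Torus.lineDeriv]

/-- **`div((u·∇)w) = Σᵢⱼ (∂ᵢu)ⱼ (∂ⱼw)ᵢ`** for smooth `u`, `w` with `div w = 0` (Leibniz, Schwarz on `w`, and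
`Σⱼ uⱼ ∂ⱼ(div w) = 0`; the tree's `divergence_convect_self` with two fields — the right-hand side of the rapid
pressure Poisson equation). [cite: BuckmasterEtAl2018, §3.1 (proof of Prop. 3.1: −Δp = ∇v·∇v)] -/
theorem divergence_convect_eq_sum_sum {u w : UnitAddTorus d → EuclideanSpace ℝ d} (hu : Torus.IsSmooth u)
    (hw : Torus.IsSmooth w) (hdiv : Torus.IsDivFree w) (x : UnitAddTorus d) :
    Torus.divergence (Torus.convect u w) x =
      ∑ i, ∑ j, Torus.partialDeriv i u x j * Torus.partialDeriv j w x i := by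
  have h1u : Torus.IsContDiff 1 u := hu.isContDiff (by simp)
  have h1w : Torus.IsContDiff 1 w := hw.isContDiff (by simp)
  have huj : ∀ j, Torus.IsSmooth (fun y => u y j) := fun j => hu.apply j
  have hDji : ∀ j i, Torus.IsSmooth (fun y => Torus.partialDeriv j w y i) := fun j i => (hw.partialDeriv j).apply i
  have hcomp : ∀ i, (fun y => Torus.convect u w y i) = fun y => ∑ j, u y j * Torus.partialDeriv j w y i :=
    fun i => funext fun y => convect_apply_coord_sum' h1w y i
  have hterm : ∀ i j, Torus.IsContDiff 1 (fun y => u y j * Torus.partialDeriv j w y i) := fun i j =>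
    ((huj j).smul' (hDji j i)).isContDiff (by simp)
  have hdiff : ∀ i, Torus.partialDeriv i (fun y => Torus.convect u w y i) x =
      ∑ j, (u x j * Torus.partialDeriv i (fun y => Torus.partialDeriv j w y i) x +
        Torus.partialDeriv i u x j * Torus.partialDeriv j w x i) := by
    intro i
    rw [hcomp i, Torus.partialDeriv_finset_sum Finset.univ (fun j _ => hterm i j)]
    refine Finset.sum_congr rfl fun j _ => ?_
    rw [Torus.partialDeriv_mul ((huj j).isContDiff (by simp)) ((hDji j i).isContDiff (by simp)),
      Torus.partialDeriv_apply_coord h1u]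
  have hswap : ∀ i j, Torus.partialDeriv i (fun y => Torus.partialDeriv j w y i) x =
      Torus.partialDeriv j (fun y => Torus.partialDeriv i w y i) x := by
    intro i j
    rw [Torus.partialDeriv_apply_coord ((hw.partialDeriv j).isContDiff (by simp)),
      Torus.partialDeriv_comm hw i j x,
      ← Torus.partialDeriv_apply_coord ((hw.partialDeriv i).isContDiff (by simp))]
  have hdiv0 : ∀ j, ∑ i, Torus.partialDeriv j (fun y => Torus.partialDeriv i w y i) x = 0 := by
    intro j
    have hti : ∀ i, Torus.IsContDiff 1 (fun y => Torus.partialDeriv i w y i) :=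
      fun i => (hDji i i).isContDiff (by simp)
    rw [← Torus.partialDeriv_finset_sum Finset.univ (fun i _ => hti i)]
    have hfun : (fun y => ∑ i, Torus.partialDeriv i w y i) = fun _ => (0 : ℝ) := by
      funext y
      have h := hdiv y
      rw [Torus.divergence] at h
      rw [← h]
      exact Finset.sum_congr rfl fun i _ => (Torus.partialDeriv_apply_coord h1w i y i).symm
    rw [hfun]
    simp [Torus.partialDeriv, Torus.lineDeriv]
  rw [Torus.divergence]
  simp_rw [hdiff]
  simp only [Finset.sum_add_distrib]
  have hfirst : ∑ i, ∑ j, u x j * Torus.partialDeriv i (fun y => Torus.partialDeriv j w y i) x = 0 := by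
    calc ∑ i, ∑ j, u x j * Torus.partialDeriv i (fun y => Torus.partialDeriv j w y i) x
        = ∑ i, ∑ j, u x j * Torus.partialDeriv j (fun y => Torus.partialDeriv i w y i) x :=
          Finset.sum_congr rfl fun i _ => Finset.sum_congr rfl fun j _ => by rw [hswap i j]
      _ = ∑ j, ∑ i, u x j * Torus.partialDeriv j (fun y => Torus.partialDeriv i w y i) x := Finset.sum_comm
      _ = ∑ j, u x j * ∑ i, Torus.partialDeriv j (fun y => Torus.partialDeriv i w y i) x :=
          Finset.sum_congr rfl fun j _ => (Finset.mul_sum _ _ _).symm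
      _ = 0 := Finset.sum_eq_zero fun j _ => by rw [hdiv0 j, mul_zero]
  rw [hfirst, zero_add]

end Calculus

/-! ## §2 The rapid pressure of a linearised response -/

section Pressure

variable {d : Type*} [Fintype d] [DecidableEq d]
variable {a b ν : ℝ} {u w : ℝ → UnitAddTorus d → EuclideanSpace ℝ d} {q : ℝ → UnitAddTorus d → ℝ}

/-- **The pressure Poisson equation of the linearised Navier–Stokes equation (rapid pressure).**  Let `u` be jointly
smooth on `[a, b] × 𝕋^d` (`a < b`) with divergence-free slices and `(w, q)` a jointly smooth solution of
`∂ₜw + (u·∇)w + (w·∇)u = νΔw − ∇q`, `div w = 0` (one-sided time derivative within `[a, b]`).  Then at every `t ∈ [a, b]`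
and `x`: `Δq = −div((u·∇)w + (w·∇)u) = −2 Σᵢⱼ (∂ᵢu)ⱼ (∂ⱼw)ᵢ` — take the divergence of the equation: `div ∂ₜw = 0`
(`IsSmoothSpaceTimeOn.isDivFree_timeDerivWithin`), `div Δw = 0` (`divergence_laplacian_eq_zero`), `div ∇q = Δq`, and
`div((u·∇)w) = div((w·∇)u) = Σᵢⱼ (∂ᵢu)ⱼ(∂ⱼw)ᵢ` (`divergence_convect_eq_sum_sum`).
[cite: MajdaBertozziCUP2002, §1.8 (1.83) (Δp = −Σ ∂ᵢvⱼ ∂ⱼvᵢ, the pressure Poisson equation); ConstantinFoiasNSE1988, Ch. 14 (14.3)–(14.4)] -/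
theorem laplacian_pressure_eq
    (hu : Torus.IsSmoothSpaceTimeOn (Icc a b) u) (hudiv : ∀ t ∈ Icc a b, Torus.IsDivFree (u t))
    (hw : Torus.IsSmoothSpaceTimeOn (Icc a b) w) (hq : Torus.IsSmoothSpaceTimeOn (Icc a b) q)
    (hwdiv : ∀ t ∈ Icc a b, Torus.IsDivFree (w t))
    (hlin : ∀ t ∈ Icc a b, ∀ x, Torus.timeDerivWithin (Icc a b) w t x + Torus.convect (u t) (w t) x +
      Torus.convect (w t) (u t) x = ν • Torus.laplacian (w t) x - Torus.gradient (q t) x)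
    (hab : a < b) {t : ℝ} (ht : t ∈ Icc a b) (x : UnitAddTorus d) :
    Torus.laplacian (q t) x =
      -(2 * ∑ i, ∑ j, Torus.partialDeriv i (u t) x j * Torus.partialDeriv j (w t) x i) := by
  have hwt : Torus.IsSmooth (w t) := hw.isSmooth_slice ht
  have hut : Torus.IsSmooth (u t) := hu.isSmooth_slice ht
  have hqt : Torus.IsSmooth (q t) := hq.isSmooth_slice ht
  have hdt : Torus.IsSmooth (Torus.timeDerivWithin (Icc a b) w t) :=
    hw.isSmooth_timeDerivWithin (uniqueDiffOn_Icc hab) ht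
  -- the pressure gradient from the equation
  have hgrad : ∀ y, Torus.gradient (q t) y = ν • Torus.laplacian (w t) y - Torus.timeDerivWithin (Icc a b) w t y -
      Torus.convect (u t) (w t) y - Torus.convect (w t) (u t) y := by
    intro y
    have h := hlin t ht y
    have h' : ν • Torus.laplacian (w t) y = Torus.timeDerivWithin (Icc a b) w t y + Torus.convect (u t) (w t) y +
        Torus.convect (w t) (u t) y + Torus.gradient (q t) y := by
      rw [h]
      abel
    rw [h']
    abel
  -- the four component functions and their smoothness
  set A : d → UnitAddTorus d → ℝ := fun i y => Torus.laplacian (w t) y i with hA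
  set B : d → UnitAddTorus d → ℝ := fun i y => Torus.timeDerivWithin (Icc a b) w t y i with hB
  set C : d → UnitAddTorus d → ℝ := fun i y => Torus.convect (u t) (w t) y i with hC
  set E : d → UnitAddTorus d → ℝ := fun i y => Torus.convect (w t) (u t) y i with hE
  have hA1 : ∀ i, Torus.IsContDiff 1 (A i) := fun i => (hwt.laplacian.apply i).isContDiff (by simp)
  have hB1 : ∀ i, Torus.IsContDiff 1 (B i) := fun i => (hdt.apply i).isContDiff (by simp)
  have hC1 : ∀ i, Torus.IsContDiff 1 (C i) := fun i => ((hut.convect hwt).apply i).isContDiff (by simp)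
  have hE1 : ∀ i, Torus.IsContDiff 1 (E i) := fun i => ((hwt.convect hut).apply i).isContDiff (by simp)
  -- components of the pressure gradient
  have hcomp : ∀ i, (fun y => Torus.gradient (q t) y i) = ν • A i - B i - C i - E i := by
    intro i
    funext y
    rw [hgrad y]
    simp only [hA, hB, hC, hE, Pi.sub_apply, Pi.smul_apply, WithLp.ofLp_sub, WithLp.ofLp_smul, smul_eq_mul]
  -- partial derivatives of the components
  have hpd : ∀ i, Torus.partialDeriv i (fun y => Torus.gradient (q t) y i) x =
      ν * Torus.partialDeriv i (A i) x - Torus.partialDeriv i (B i) x - Torus.partialDeriv i (C i) x -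
        Torus.partialDeriv i (E i) x := by
    intro i
    have hνA : Torus.IsContDiff 1 (ν • A i) := (hA1 i).smul ν
    have hAB : Torus.IsContDiff 1 (ν • A i - B i) := hνA.sub (hB1 i)
    have hABC : Torus.IsContDiff 1 (ν • A i - B i - C i) := hAB.sub (hC1 i)
    rw [hcomp i, Torus.partialDeriv_sub hABC (hE1 i), Pi.sub_apply, Torus.partialDeriv_sub hAB (hC1 i), Pi.sub_apply,
      Torus.partialDeriv_sub hνA (hB1 i), Pi.sub_apply, Torus.partialDeriv_const_smul (hA1 i), Pi.smul_apply,
      smul_eq_mul]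
  -- the divergences of the four terms
  have hdA : ∑ i, Torus.partialDeriv i (A i) x = 0 := divergence_laplacian_eq_zero hwt (hwdiv t ht) x
  have hdB : ∑ i, Torus.partialDeriv i (B i) x = 0 := hw.isDivFree_timeDerivWithin hab hwdiv ht x
  have hdC : ∑ i, Torus.partialDeriv i (C i) x =
      ∑ i, ∑ j, Torus.partialDeriv i (u t) x j * Torus.partialDeriv j (w t) x i :=
    divergence_convect_eq_sum_sum hut hwt (hwdiv t ht) x
  have hdE : ∑ i, Torus.partialDeriv i (E i) x =
      ∑ i, ∑ j, Torus.partialDeriv i (u t) x j * Torus.partialDeriv j (w t) x i := by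
    have h := divergence_convect_eq_sum_sum hwt hut (hudiv t ht) x
    rw [Torus.divergence] at h
    rw [show (∑ i, Torus.partialDeriv i (E i) x) = ∑ i, Torus.partialDeriv i (fun y => Torus.convect (w t) (u t) y i) x
      from rfl, h, Finset.sum_comm]
    exact Finset.sum_congr rfl fun i _ => Finset.sum_congr rfl fun j _ => mul_comm _ _
  -- assemble: `Δq = div ∇q`
  rw [← Torus.divergence_gradient_eq_laplacian_apply hqt x, Torus.divergence]
  simp_rw [hpd]
  simp only [Finset.sum_sub_distrib, ← Finset.mul_sum]
  rw [hdA, hdB, hdC, hdE]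
  ring

end Pressure

/-! ## §3 The V half-slot of the cascade -/

/-- **Rapid pressure on a V half-slot.** On `[a, b] = [tStart j + tHalf j, tStart (j+1)]` the carrier is the vertical shear
`(0, rateV j t · U_j(x₀))` (`∂₁ū = 0`, `∂₀ū = c e₁`, `c = rateV j t · U_j′(x₀)`, `partialDeriv_field_of_mem_V`), so for
every smooth solution `(w, q)` of the linearised Navier–Stokes equation there, `Δq(t, x) = −2 c(t, x) (∂₁w(t, x))₀`: the
pressure is driven by the streamwise derivative of the CROSS-STREAM component alone (the Orr–Sommerfeld closure).
[cite: MajdaBertozziCUP2002, §1.8 (1.83) (pressure Poisson equation); ElgindiLissMattingly2025, §1 (u_α = V_α(x₁) e₂ on its half period)] -/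
theorem laplacian_pressure_eq_of_mem_V (P : CascadeParams) {j : ℕ} {ν : ℝ}
    (hu : Torus.IsSmoothSpaceTimeOn (Icc (tStart j + tHalf j) (tStart (j + 1))) P.field)
    {w : ℝ → UnitAddTorus (Fin 2) → EuclideanSpace ℝ (Fin 2)} {q : ℝ → UnitAddTorus (Fin 2) → ℝ}
    (hw : Torus.IsSmoothSpaceTimeOn (Icc (tStart j + tHalf j) (tStart (j + 1))) w)
    (hq : Torus.IsSmoothSpaceTimeOn (Icc (tStart j + tHalf j) (tStart (j + 1))) q)
    (hwdiv : ∀ t ∈ Icc (tStart j + tHalf j) (tStart (j + 1)), Torus.IsDivFree (w t))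
    (hlin : ∀ t ∈ Icc (tStart j + tHalf j) (tStart (j + 1)), ∀ x,
      Torus.timeDerivWithin (Icc (tStart j + tHalf j) (tStart (j + 1))) w t x +
        Torus.convect (P.field t) (w t) x + Torus.convect (w t) (P.field t) x =
          ν • Torus.laplacian (w t) x - Torus.gradient (q t) x)
    {t : ℝ} (ht : t ∈ Icc (tStart j + tHalf j) (tStart (j + 1))) (x : UnitAddTorus (Fin 2)) :
    Torus.laplacian (q t) x =
      -(2 * (P.rateV j t * deriv (P.U j) (Torus.repr x 0) * Torus.partialDeriv 1 (w t) x 0)) := by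
  rw [laplacian_pressure_eq hu (fun _ hs => P.isDivFree_field_of_mem_V hs) hw hq hwdiv hlin (tMid_lt_tStart_succ j) ht x,
    Fin.sum_univ_two, Fin.sum_univ_two, Fin.sum_univ_two, (P.partialDeriv_field_of_mem_V ht x).1,
    (P.partialDeriv_field_of_mem_V ht x).2]
  simp

end Summit.AnomalousDissipation.AnomalousDissipation.Theorems.SawtoothPulseCascade.K2Classical

end
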